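import Summits.QuantumFields.YangMills.Theorems.BalabanUVNodesN15TwoGridCellMean
import HarnessLib

/-!
# N15 (NE2) — PROGRAMME M-II «THE FIRST-ORDER LAYER BY PARTS», part II-A: THE EXACT VALUE-ONLY DEFECT IDENTITY OF THE FIRST-ORDER DRESSED PAIR — the η-defect
# `𝔇₀ = X′P − PX` solves `𝔇₀ = S + (G′V₁′)𝔇₀` with a source term `S` that contains NO defect of the gradient component and NO fit of the zeroth-order coefficient

WHO ∕ WHEN.  Cell `pub-ymgap`, seat `pub-ymgap-dag-n15-a` (KNIT-BY-NAME seat of Track-A DAG node N15 = NE2, g24); `--kind proof --supports stmt-QuantumFields-27366 --as helper` (K3⁸;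
count-neutral).  Over `T4EtaRateDefect.idef`, `T4EtaRateCoeffDefect.pull`, `B6Prop26Gluing.mulOp` and parts 34∕M-A (`symbOp`, `sD`, `sA`, `sTinv`, `symbOp_sD_sA_comp_pull`) BY NAME; nothing modified.
WHY (programme M §g24.3 (iii), located).  Programme M (M-A…M-F) made the ZEROTH-order background layer (3.35)-honest: the two-grid fit of the zeroth-order coefficient `c` is never needed
pointwise — the sandwiched defect `G′∘𝔇(M_{c′}, M_{c̄})∘X` is small by the «G∇*» letters.  For the FIRST-order species `V₁ = M_c + Σ_μ M_{a_μ}∇_μ` the lineage's stacked device (n15-b B1b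
`bgPair`: the jet `(X, ∇_μX)`) couples the value defect `𝔇₀ = 𝔇(X′, X)` to the gradient defect `𝔇₁ = 𝔇(∇′X′, ∇X)`, and `𝔇₁`'s `c`-term is `(∇′G′)∘M_{c′−c̄π}∘P∘X` — the MIXED letter
«∇G∇*», which the sup-block currency does not carry ((1.112)–(1.113) Hölder; (1.114) L²).  THIS FILE removes `𝔇₁` from the value equation EXACTLY: with `∇′X′P − P∇X = ∇′(𝔇₀ + (1 − A′)PX)`
(King's box filter `A′`: `∇′A′P = P∇`) and the lattice Leibniz rule `M_{a′}∇′_μ = ∇′_μ M_{S⁻¹a′} − M_{∇⁻a′}`, the value defect solves the ONE-UNKNOWN fixed point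
`𝔇₀ = S + (G′∘V₁′)∘𝔇₀`, `S = 𝔇(G′,G)(1 + V₁X) + G′𝔇(M_{c′},M_c)X + Σ_μ [G′M_{a′_μ}∇′_μ(1 − A′_μ)PX + G′𝔇(M_{a′_μ},M_{a_μ})∇_μX]` — every term of `S` is a `U ≡ 1` defect, a SANDWICHED
zeroth-order coefficient defect (M-C's input shape), the legitimate (3.35) fit of the first-order coefficients `a_μ`, or the cell-face term `(1 − A′)PX = O(L^{−k})·∇X`; and `G′∘V₁′` has the
BY-PARTS form `G′M_{c′} + Σ_μ[(G′∇′_μ)M_{S⁻¹a′_μ} − G′M_{∇⁻a′_μ}]` whose letters are (1.110)'s «G», «G∇» and (3.35)'s `|c|, |a|, |∇a|` — no «∇G∇*», no `∇c`, no `∇∇a`.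
WHAT ([folklore] linear algebra; 0 def).  §14 ★★★ `idef_firstOrder_fix` (generic lattices `X, X′`, pairing `π`, abstract pieces: the fixed point above from the two (3.65)-shaped equations,
the jet interpretation `Y_μ = ∇_μX`, `Y′_μ = ∇′_μX′`, and the transport law `∇′_μA′_μP = P∇_μ`); ★ `comp_mulOp_grad_byParts` (`G′M_{a′}∇′ = (G′∇′)M_{ã′} − G′M_{b′}` from the Leibniz
hypothesis); §15 the torus instances of the two structural hypotheses: ★ `mulOp_comp_sD_eq` (lattice Leibniz `M_a∘ρ(sD_μ c) = ρ(sD_μ c)∘M_{a∘(·−e_μ)} − M_{c·(a − a∘(·−e_μ))}` on `Tor (fine n M)`),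
`sD_sA_pull_law` (`symbOp_sD_sA_comp_pull` re-keyed with `c·L^m = n′`).
HONEST FRAMING ∕ LIMITS.  Exact operator algebra; no estimate; the source term `S` and the step `G′V₁′` are BOUNDED in the sequels (II-B∕II-C) from landed letters; nothing of [B5]∕[B6]∕[B9]
asserted; NE2⁺ NOT printed ∕ proved; no statement of record touched; N15 NOT discharged; K3⁸ OPEN; counts UNMOVED (typed 28∕28 · discharged 5∕27); NOT infinite volume ∕ OS ∕ mass gap ∕ Clay.
-/

open scoped BigOperators
open Finset

namespace Summit.QuantumFields.YangMills.BalabanUVNodes.N15.TwoGrid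

open Literature.MathematicalPhysics.QuantumFieldTheory.Balaban1983to89
open Literature.MathematicalPhysics.QuantumFieldTheory.Balaban1983to89.T4EtaRateDefect (idef idef_apply)
open Literature.MathematicalPhysics.QuantumFieldTheory.Balaban1983to89.T4EtaRateCoeffDefect (pull pull_apply)
open Literature.MathematicalPhysics.QuantumFieldTheory.Balaban1983to89.B6Prop26Gluing (mulOp mulOp_apply)
open Literature.MathematicalPhysics.QuantumFieldTheory.Balaban1983to89.B5Prop11Plancherel (Tor fine unitVec)
open Summit.QuantumFields.YangMills.BalabanUVNodes.N15.VectorPiece (kingPrV)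

variable {d : ℕ}

/-! ## §14 ★★★ The value-only fixed point of the first-order dressed pair's η-defect -/

section Generic

variable {X X' J : Type} [Fintype J] (π : X' → X)

/-- ★ **BY PARTS ON THE SOURCE**: from the lattice Leibniz rule `M_{a′}∘∇′ = ∇′∘M_{ã′} − M_{b′}` (`ã′ = a′(· − e)`, `b′ = ∇⁻a′`), `G′∘M_{a′}∘∇′ = (G′∘∇′)∘M_{ã′} − G′∘M_{b′}` — the derivative moved
onto the `U ≡ 1` piece's SOURCE («G∇», (1.110)), the price a multiplier by the coefficient's own difference quotient ((3.35)'s `|∇^ηA|`). [cite: Balaban1985BackgroundPropagators, (3.35) p.396,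
(3.52) p.400 (shapes); Balaban1984PropagatorsI, Prop. 1.2 (1.110) p.35 (the letter «G∇J»)] -/
theorem comp_mulOp_grad_byParts (G' D' : (X' → ℝ) →ₗ[ℝ] (X' → ℝ)) {a' at' b' : X' → ℝ} (hLeib : mulOp a' ∘ₗ D' = D' ∘ₗ mulOp at' - mulOp b') :
    G' ∘ₗ (mulOp a' ∘ₗ D') = (G' ∘ₗ D') ∘ₗ mulOp at' - G' ∘ₗ mulOp b' := by
  rw [hLeib, LinearMap.comp_sub, LinearMap.comp_assoc]

/-- ★★★ **THE EXACT VALUE-ONLY FIXED POINT OF THE FIRST-ORDER DRESSED PAIR's η-DEFECT.**  Coarse data on `X`: a piece `G`, coefficients `c, a_μ`, difference quotients `∇_μ` (`Dc`), the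
dressed value `X` and gradient components `Y_μ` with the (3.65)-shaped fixed point `X = G + G∘(M_cX + Σ_μ M_{a_μ}Y_μ)` and the jet interpretation `Y_μ = ∇_μ∘X`; fine data on `X′` likewise
(`G′, c′, a′_μ, ∇′_μ = Df, X′` with `X′ = G′ + G′∘V₁′∘X′`, `V₁′ := M_{c′} + Σ_μ M_{a′_μ}∘∇′_μ`); the prolongation `P = pull π` and fine box filters `A′_μ` with the transport law `∇′_μ∘A′_μ∘P =
P∘∇_μ`.  THEN `𝔇₀ := 𝔇(X′, X) = X′P − PX` satisfies `𝔇₀ = S + (G′∘V₁′)∘𝔇₀` with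
`S = 𝔇(G′,G)∘(1 + M_cX + ΣM_{a_μ}Y_μ) + G′∘𝔇(M_{c′},M_c)∘X + Σ_μ [ (G′∘M_{a′_μ}∘∇′_μ)∘(P − A′_μP)∘X + G′∘𝔇(M_{a′_μ},M_{a_μ})∘Y_μ ]` — NO defect of the gradient component, NO derivative of
a defect. [cite: Balaban1985BackgroundPropagators, (3.62)–(3.65) pp.402–403 (mechanism); Balaban1984PropagatorsII, (2.52)–(2.56) pp.232–233 (defect bookkeeping: shape); King1986, p.664
(the prolongation)] -/
theorem idef_firstOrder_fix (G Xv : (X → ℝ) →ₗ[ℝ] (X → ℝ)) (Y Dc : J → (X → ℝ) →ₗ[ℝ] (X → ℝ)) (c : X → ℝ) (a : J → X → ℝ)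
    (G' Xv' : (X' → ℝ) →ₗ[ℝ] (X' → ℝ)) (Df Af : J → (X' → ℝ) →ₗ[ℝ] (X' → ℝ)) (c' : X' → ℝ) (a' : J → X' → ℝ)
    (hfix : Xv = G + G ∘ₗ (mulOp c ∘ₗ Xv + ∑ μ, mulOp (a μ) ∘ₗ Y μ))
    (hfix' : Xv' = G' + G' ∘ₗ ((mulOp c' + ∑ μ, mulOp (a' μ) ∘ₗ Df μ) ∘ₗ Xv'))
    (hY : ∀ μ, Y μ = Dc μ ∘ₗ Xv) (hPA : ∀ μ, Df μ ∘ₗ (Af μ ∘ₗ pull π) = pull π ∘ₗ Dc μ) :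
    idef (pull π) (pull π) Xv' Xv =
      (idef (pull π) (pull π) G' G ∘ₗ (LinearMap.id + (mulOp c ∘ₗ Xv + ∑ μ, mulOp (a μ) ∘ₗ Y μ))
        + G' ∘ₗ (idef (pull π) (pull π) (mulOp c') (mulOp c) ∘ₗ Xv)
        + ∑ μ, ((G' ∘ₗ (mulOp (a' μ) ∘ₗ Df μ)) ∘ₗ ((pull π - Af μ ∘ₗ pull π) ∘ₗ Xv) + G' ∘ₗ (idef (pull π) (pull π) (mulOp (a' μ)) (mulOp (a μ)) ∘ₗ Y μ)))
      + (G' ∘ₗ (mulOp c' + ∑ μ, mulOp (a' μ) ∘ₗ Df μ)) ∘ₗ idef (pull π) (pull π) Xv' Xv := by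
  refine LinearMap.ext fun φ => ?_
  -- the structural facts, applied to the vectors at hand and expanded into additive atoms
  have e1 := LinearMap.congr_fun hfix' (pull π φ)
  have e2 := congrArg (pull π) (LinearMap.congr_fun hfix φ)
  have e4 : ∀ μ, Df μ (Af μ (pull π (Xv φ))) = pull π (Dc μ (Xv φ)) := fun μ => by
    have e := LinearMap.congr_fun (hPA μ) (Xv φ)
    simpa only [LinearMap.comp_apply] using e
  simp only [hY] at e2 ⊢
  simp only [LinearMap.comp_apply, LinearMap.add_apply, LinearMap.sub_apply, LinearMap.sum_apply, LinearMap.id_apply, idef_apply, map_add, map_sub, map_sum,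
    Finset.sum_add_distrib, Finset.sum_sub_distrib] at e1 e2 ⊢
  -- substitute the fixed points ONCE (leading occurrences only), then the transport law everywhere
  nth_rw 1 [e1]
  nth_rw 1 [e2]
  simp only [e4]
  abel

end Generic

/-! ## §15 The torus instances of the two structural hypotheses -/

section Torus

variable (M : Fin (d + 1) → ℕ) [∀ μ, NeZero (M μ)] (n : ℕ) [NeZero n]

omit [∀ μ, NeZero (M μ)] [NeZero n] in
/-- ★ **THE LATTICE LEIBNIZ RULE, BY-PARTS FORM**: `M_a∘ρ(sD_μ c) = ρ(sD_μ c)∘M_{a(·−e_μ)} − M_{c·(a − a(·−e_μ))}` — `a(x)·c(f(x+e) − f(x)) = c((ãf)(x+e) − (ãf)(x)) − c(a(x) − a(x−e))·f(x)`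
with `ã = a(· − e_μ)`; no shift lands on `f`. [cite: Balaban1984PropagatorsI, (1.31) p.23 (difference quotients)] -/
theorem mulOp_comp_sD_eq (μ : Fin (d + 1)) (cc : ℝ) (a : Tor (fine n M) × Fin (d + 1) → ℝ) :
    mulOp a ∘ₗ symbOp M n (sD M n μ cc) =
      symbOp M n (sD M n μ cc) ∘ₗ mulOp (fun z => a (z.1 - unitVec (fine n M) μ, z.2)) - mulOp (fun z => cc * (a z - a (z.1 - unitVec (fine n M) μ, z.2))) := by
  refine LinearMap.ext fun f => funext fun z => ?_
  simp only [LinearMap.comp_apply, LinearMap.sub_apply, Pi.sub_apply, mulOp_apply, symbOp_sD_apply, add_sub_cancel_right]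
  ring

variable (L k m : ℕ) [NeZero L]

/-- THE TRANSPORT LAW OF THE GRADIENT (part 34 `symbOp_sD_sA_comp_pull`, lattice factors of record `n′ = L^m·L^k`, `n = L^k`): `∇′_μ∘(A′_μ∘P) = P∘∇_μ` with King's box filter `A′_μ = ρ′(sA μ L^m)`.
[cite: King1986, p.664 (prolongation convention); Balaban1984PropagatorsI, (1.31) p.23] -/
theorem sD_sA_pull_law (μ : Fin (d + 1)) :
    symbOp M (L ^ m * L ^ k) (sD M (L ^ m * L ^ k) μ ((L ^ m * L ^ k : ℕ) : ℝ)) ∘ₗ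
        (symbOp M (L ^ m * L ^ k) (sA M (L ^ m * L ^ k) μ (L ^ m)) ∘ₗ pull (kingPrV L k m M)) =
      pull (kingPrV L k m M) ∘ₗ symbOp M (L ^ k) (sD M (L ^ k) μ ((L ^ k : ℕ) : ℝ)) := by
  have e : ((L ^ m * L ^ k : ℕ) : ℝ) = ((L ^ k : ℕ) : ℝ) * (L : ℝ) ^ m := by push_cast; ring
  rw [e]
  exact symbOp_sD_sA_comp_pull M L k m μ ((L ^ k : ℕ) : ℝ)

end Torus

end Summit.QuantumFields.YangMills.BalabanUVNodes.N15.TwoGrid
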